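import Mathlib
import Summits.MatrixMultiplication.MatrixMultiplication.Theorems.HiddenToeplitzCornersHiddenCornerLemmaRStein

/-!
# Stub `stub_dualityAnnihilator` (line `frobenius-dual-short-syzygies`, crux stmt-MatrixMultiplication-10752)

Support file for crux item `stmt-MatrixMultiplication-10752`
(`Summit.MatrixMultiplication.MatrixMultiplication.Theses.HiddenToeplitzCorners.HiddenCornerLemmaR`),
line `frobenius-dual-short-syzygies`, registered stub `stub_dualityAnnihilator` ("the lever").

Notation (written out verbatim in the statements): `Z` is the lower shift on `ℂ^N`
(`Z i j = [i = j+1]`), `∇M = M − Z M Zᵀ` the Stein displacement, `U(v) = Σ_i v_i (Zᵀ)^i`.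
In the G-constant class (`∇(T a b) = G₀ (H₁ a b)ᵀ` with a CONSTANT `G₀ : N × p`), if
`Λ = [λ_1 … λ_r]` satisfies `∀ k, Σ_c U(U(g_k) λ_c) e_c = 0` (`g_k` = column `k` of `G₀`,
`e_c` = column `c` of the frame `E`) and the pencil hides the corner `T(X) E = F X`, then `Λᵀ F = 0`.

Proof: general Stein inversion `M = Σ_{m<N} Z^m (∇M) (Zᵀ)^m` (`hclR_eq_stein_sum_general`), the
adjunction `λ ⬝ (Z^m D (Zᵀ)^m e) = ((Zᵀ)^m λ) ⬝ (D ((Zᵀ)^m e))`, the coincidence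
`(U(g) λ)_m = g ⬝ ((Zᵀ)^m λ)` (`hclR_corrMat_mulVec_apply`), and the corner at the matrix unit
`X = single a b 1`.  Pure finite-dimensional bookkeeping. [folklore]
-/

set_option linter.dupNamespace false

namespace Summit.MatrixMultiplication.MatrixMultiplication.Cruxes.HiddenCornerLemmaR.FrobeniusDualShortSyzygies

open scoped Matrix BigOperators
open Summit.MatrixMultiplication.MatrixMultiplication.Theorems

/-- General Stein inversion: partial sums telescope, `Σ_{m<n} Z^m (∇M) (Zᵀ)^m = M − Z^n M (Zᵀ)^n`. -/
theorem hclR_stein_partial_sum {N : ℕ} (M : Matrix (Fin N) (Fin N) ℂ) (n : ℕ) :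
    (∑ m ∈ Finset.range n,
        (Matrix.of fun i j : Fin N => if (i : ℕ) = (j : ℕ) + 1 then (1 : ℂ) else 0) ^ m *
          (M - (Matrix.of fun i j : Fin N => if (i : ℕ) = (j : ℕ) + 1 then (1 : ℂ) else 0) * M *
            (Matrix.of fun i j : Fin N => if (i : ℕ) = (j : ℕ) + 1 then (1 : ℂ) else 0)ᵀ) *
          ((Matrix.of fun i j : Fin N => if (i : ℕ) = (j : ℕ) + 1 then (1 : ℂ) else 0)ᵀ) ^ m) =
      M - (Matrix.of fun i j : Fin N => if (i : ℕ) = (j : ℕ) + 1 then (1 : ℂ) else 0) ^ n * M *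
        ((Matrix.of fun i j : Fin N => if (i : ℕ) = (j : ℕ) + 1 then (1 : ℂ) else 0)ᵀ) ^ n := by
  set Z := (Matrix.of fun i j : Fin N => if (i : ℕ) = (j : ℕ) + 1 then (1 : ℂ) else 0) with hZ
  induction n with
  | zero => simp
  | succ n ih =>
    rw [Finset.sum_range_succ, ih]
    have e1 : Z ^ n * (M - Z * M * Zᵀ) * (Zᵀ) ^ n =
        Z ^ n * M * (Zᵀ) ^ n - Z ^ (n + 1) * M * (Zᵀ) ^ (n + 1) := by
      rw [pow_succ, pow_succ']
      simp only [Matrix.mul_sub, Matrix.sub_mul, Matrix.mul_assoc]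
    rw [e1]
    abel

/-- General Stein inversion: if `M − Z M Zᵀ = D` then `M = Σ_{m<N} Z^m D (Zᵀ)^m`. -/
theorem hclR_eq_stein_sum_general {N : ℕ} (M D : Matrix (Fin N) (Fin N) ℂ)
    (h : M - (Matrix.of fun i j : Fin N => if (i : ℕ) = (j : ℕ) + 1 then (1 : ℂ) else 0) * M *
      (Matrix.of fun i j : Fin N => if (i : ℕ) = (j : ℕ) + 1 then (1 : ℂ) else 0)ᵀ = D) :
    M = ∑ m ∈ Finset.range N,
        (Matrix.of fun i j : Fin N => if (i : ℕ) = (j : ℕ) + 1 then (1 : ℂ) else 0) ^ m * D *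
          ((Matrix.of fun i j : Fin N => if (i : ℕ) = (j : ℕ) + 1 then (1 : ℂ) else 0)ᵀ) ^ m := by
  rw [← h, hclR_stein_partial_sum M N, hclR_shift_pow_N]
  simp

/-- Symmetry of the up-shift action: `((Zᵀ)^i v)_j = v_{i+j} = ((Zᵀ)^j v)_i`. -/
theorem hclR_shiftT_pow_mulVec_symm {N : ℕ} (v : Fin N → ℂ) (i j : Fin N) :
    (((Matrix.of fun i j : Fin N => if (i : ℕ) = (j : ℕ) + 1 then (1 : ℂ) else 0)ᵀ) ^ (i : ℕ) *ᵥ v) j =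
      (((Matrix.of fun i j : Fin N => if (i : ℕ) = (j : ℕ) + 1 then (1 : ℂ) else 0)ᵀ) ^ (j : ℕ) *ᵥ v) i := by
  rw [hclR_shiftT_pow_mulVec, hclR_shiftT_pow_mulVec]
  by_cases h : (j : ℕ) + (i : ℕ) < N
  · have h' : (i : ℕ) + (j : ℕ) < N := by omega
    rw [dif_pos h, dif_pos h']
    congr 1
    exact Fin.ext (by simp only; omega)
  · have h' : ¬ ((i : ℕ) + (j : ℕ) < N) := by omega
    rw [dif_neg h, dif_neg h']

/-- The key coincidence: `(U(g) v)_j = g ⬝ ((Zᵀ)^j v)` where `U(g) = Σ_i g_i (Zᵀ)^i`. -/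
theorem hclR_corrMat_mulVec_apply {N : ℕ} (g v : Fin N → ℂ) (j : Fin N) :
    ((∑ i : Fin N, g i •
        ((Matrix.of fun i j : Fin N => if (i : ℕ) = (j : ℕ) + 1 then (1 : ℂ) else 0)ᵀ) ^ (i : ℕ)) *ᵥ v) j =
      g ⬝ᵥ (((Matrix.of fun i j : Fin N => if (i : ℕ) = (j : ℕ) + 1 then (1 : ℂ) else 0)ᵀ) ^ (j : ℕ) *ᵥ v) := by
  rw [Matrix.sum_mulVec, Finset.sum_apply, dotProduct]
  refine Finset.sum_congr rfl fun i _ => ?_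
  rw [Matrix.smul_mulVec, Pi.smul_apply, smul_eq_mul, hclR_shiftT_pow_mulVec_symm]

/-- Pairing identity: if `∇M = G₀ Hᵀ` then `v ⬝ (M e) = Σ_k h_k ⬝ ((Σ_j (U(g_k) v)_j (Zᵀ)^j) e)`
(`g_k`, `h_k` = columns `k` of `G₀`, `H`; `U(g) = Σ_i g_i (Zᵀ)^i`). -/
theorem hclR_pairing {N p : ℕ} (M : Matrix (Fin N) (Fin N) ℂ) (G₀ H : Matrix (Fin N) (Fin p) ℂ)
    (h : M - (Matrix.of fun i j : Fin N => if (i : ℕ) = (j : ℕ) + 1 then (1 : ℂ) else 0) * M *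
      (Matrix.of fun i j : Fin N => if (i : ℕ) = (j : ℕ) + 1 then (1 : ℂ) else 0)ᵀ = G₀ * Hᵀ)
    (v e : Fin N → ℂ) :
    v ⬝ᵥ (M *ᵥ e) =
      ∑ k : Fin p, Hᵀ k ⬝ᵥ
        ((∑ j : Fin N,
          (((∑ i : Fin N, G₀ i k •
              (Matrix.of fun i j : Fin N => if (i : ℕ) = (j : ℕ) + 1 then (1 : ℂ) else 0)ᵀ ^ (i : ℕ))
            *ᵥ v) j) •
          (Matrix.of fun i j : Fin N => if (i : ℕ) = (j : ℕ) + 1 then (1 : ℂ) else 0)ᵀ ^ (j : ℕ))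
        *ᵥ e) := by
  rw [hclR_eq_stein_sum_general M _ h]
  set Z := (Matrix.of fun i j : Fin N => if (i : ℕ) = (j : ℕ) + 1 then (1 : ℂ) else 0) with hZ
  have rhs : ∀ k : Fin p,
      Hᵀ k ⬝ᵥ ((∑ j : Fin N, (((∑ i : Fin N, G₀ i k • Zᵀ ^ (i : ℕ)) *ᵥ v) j) • Zᵀ ^ (j : ℕ)) *ᵥ e) =
        ∑ j : Fin N, (G₀ᵀ k ⬝ᵥ (Zᵀ ^ (j : ℕ) *ᵥ v)) * (Hᵀ k ⬝ᵥ (Zᵀ ^ (j : ℕ) *ᵥ e)) := by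
    intro k
    rw [Matrix.sum_mulVec, dotProduct_sum]
    refine Finset.sum_congr rfl fun j _ => ?_
    rw [Matrix.smul_mulVec, dotProduct_smul, smul_eq_mul, hZ, hclR_corrMat_mulVec_apply]
    rfl
  simp_rw [rhs]
  rw [Matrix.sum_mulVec, dotProduct_sum, Finset.sum_range, Finset.sum_comm]
  refine Finset.sum_congr rfl fun j _ => ?_
  rw [← Matrix.mulVec_mulVec, ← Matrix.mulVec_mulVec, Matrix.dotProduct_mulVec,
    ← Matrix.mulVec_transpose, Matrix.transpose_pow, ← Matrix.mulVec_mulVec,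
    Matrix.dotProduct_mulVec, dotProduct]
  refine Finset.sum_congr rfl fun k _ => ?_
  congr 1
  rw [Matrix.vecMul, dotProduct_comm]
  rfl

/-- **S2 · `stub_dualityAnnihilator`** (the lever of line `frobenius-dual-short-syzygies`).
In the G-constant class (`∇(T a b) = G₀ (H₁ a b)ᵀ`, so `T a b = Σ_k L(g_k) U(h_{k,ab})` by Stein
inversion, `g_k` = column `k` of `G₀`), every `Λ` in the explicit annihilator
`{Λ : ∀ k, Σ_c U(U(g_k) λ_c) e_c = 0}` kills the targets of a hidden corner `T(X) E = F X`:
`Λᵀ F = 0`.  Proof: `(Λᵀ F) b a = Σ_c λ_c ⬝ (T a b e_c)` (corner at the matrix unit `X = E_{ab}`),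
and by the pairing identity `hclR_pairing` this is `Σ_k h_{k,ab} ⬝ (Σ_c U(U(g_k) λ_c) e_c) = 0`. -/
theorem stub_dualityAnnihilator :
    ∀ (r N p : ℕ) (T : Fin r → Fin r → Matrix (Fin N) (Fin N) ℂ) (E F : Matrix (Fin N) (Fin r) ℂ)
      (G₀ : Matrix (Fin N) (Fin p) ℂ) (H₁ : Fin r → Fin r → Matrix (Fin N) (Fin p) ℂ),
      (∀ X : Matrix (Fin r) (Fin r) ℂ, (∑ a : Fin r, ∑ b : Fin r, X a b • T a b) * E = F * X) →
      (∀ a b, T a b - (Matrix.of fun i j : Fin N => if (i : ℕ) = (j : ℕ) + 1 then (1 : ℂ) else 0) * T a b *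
          (Matrix.of fun i j : Fin N => if (i : ℕ) = (j : ℕ) + 1 then (1 : ℂ) else 0)ᵀ = G₀ * (H₁ a b)ᵀ) →
      ∀ Λ : Matrix (Fin N) (Fin r) ℂ,
        (∀ k : Fin p,
          (∑ c : Fin r,
            (∑ j : Fin N,
              (((∑ i : Fin N, G₀ i k •
                  (Matrix.of fun i j : Fin N => if (i : ℕ) = (j : ℕ) + 1 then (1 : ℂ) else 0)ᵀ ^ (i : ℕ))
                *ᵥ (Λᵀ c)) j) •
              (Matrix.of fun i j : Fin N => if (i : ℕ) = (j : ℕ) + 1 then (1 : ℂ) else 0)ᵀ ^ (j : ℕ))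
            *ᵥ (Eᵀ c)) = 0) →
        Λᵀ * F = 0 := by
  intro r N p T E F G₀ H₁ hcorner hdisp Λ hann
  ext b a
  -- Step 3: the corner at the matrix unit `X = single a b 1`
  have hX : (∑ a' : Fin r, ∑ b' : Fin r, Matrix.single a b (1 : ℂ) a' b' • T a' b') = T a b := by
    rw [Finset.sum_eq_single a]
    · rw [Finset.sum_eq_single b]
      · rw [Matrix.single_apply_same, one_smul]
      · intro b' _ hb'
        rw [Matrix.single_apply_of_col_ne a a (Ne.symm hb'), zero_smul]
      · intro h; exact absurd (Finset.mem_univ b) h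
    · intro a' _ ha'
      refine Finset.sum_eq_zero fun b' _ => ?_
      rw [Matrix.single_apply_of_row_ne (Ne.symm ha'), zero_smul]
    · intro h; exact absurd (Finset.mem_univ a) h
  have hunit : T a b * E = F * Matrix.single a b (1 : ℂ) := by
    have := hcorner (Matrix.single a b (1 : ℂ))
    rwa [hX] at this
  -- Step 4 (first half): the `(b, a)` entry of `Λᵀ F` is `Σ_c λ_c ⬝ (T a b *ᵥ e_c)`
  have hsum : (Λᵀ * F) b a = ∑ c : Fin r, Λᵀ c ⬝ᵥ (T a b *ᵥ Eᵀ c) := by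
    have hcol : ∀ c : Fin r, T a b *ᵥ Eᵀ c = fun n => (F * Matrix.single a b (1 : ℂ)) n c := by
      intro c
      rw [← hunit]
      ext n
      simp [Matrix.mulVec, dotProduct, Matrix.mul_apply]
    simp_rw [hcol]
    rw [Finset.sum_eq_single b]
    · rw [Matrix.mul_apply, dotProduct]
      refine Finset.sum_congr rfl fun n _ => ?_
      rw [Matrix.mul_single_apply_same, mul_one]
    · intro c _ hcb
      rw [dotProduct]
      refine Finset.sum_eq_zero fun n _ => ?_
      rw [Matrix.mul_single_apply_of_ne (hbj := hcb), mul_zero]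
    · intro h; exact absurd (Finset.mem_univ b) h
  -- Step 2 + Step 4 (second half): the pairing identity and the annihilator hypothesis
  have hzero : ∑ c : Fin r, Λᵀ c ⬝ᵥ (T a b *ᵥ Eᵀ c) = 0 := by
    rw [Finset.sum_congr rfl fun c _ => hclR_pairing (T a b) G₀ (H₁ a b) (hdisp a b) (Λᵀ c) (Eᵀ c),
      Finset.sum_comm]
    refine Finset.sum_eq_zero fun k _ => ?_
    rw [← dotProduct_sum, hann k, dotProduct_zero]
  rw [hsum, hzero, Matrix.zero_apply]

end Summit.MatrixMultiplication.MatrixMultiplication.Cruxes.HiddenCornerLemmaR.FrobeniusDualShortSyzygies
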